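import Mathlib
import HarnessLib
import Summits.FinalStateConjecture.Statement
import Literature.Geometry.Lorentzian.Stationary
import Literature.Geometry.Lorentzian.KerrData
import Literature.Geometry.Lorentzian.Einstein

/-!
# Route SignedCensus — the Assembly, frame form (item stmt-FinalStateConjecture-10006)

The assembly item of route `SignedCensus` for the Final State Conjecture:
`StaticAnchor → OpenUnderRotation → ClosedUnderRotation → NoHairToFinalState → FinalStateConjecture`
(real induction on the horizon rotation level, then the dynamical leg). It is literally the type of the
route file's sorry-free deciding theorem
`Summit.FinalStateConjecture.FinalStateConjecture.Theses.SignedCensus.closes`, and the proof below is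
that theorem's body verbatim.

Design constraint (why this file does NOT import the route module
`Summits.FinalStateConjecture.FinalStateConjecture.Theses.SignedCensus`): when an item closes, the gate
re-renders the route file with `import <closing module>` and `theorem Assembly_holds : Assembly := …`;
a closing module that itself imports the route module makes that render fail (the rev-3 episodes of
routes EIHFluxBalance / PhotonSphereChannels / SwallowTheDatum). So the theorem below is stated with the
four route statements INLINED VERBATIM (the bodies of `StaticAnchor`, `OpenUnderRotation`,
`ClosedUnderRotation` and `NoHairToFinalState`, copied from the route file rev 5) and the summit
Statement `FinalStateConjecture` by name, so that its type is definitionally (by `δ`-unfolding only) the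
route decl `Assembly`, and the route file can import this module without a cycle (pattern of
`Theorems/EIHFluxBalanceAssemblyFrame.lean` and `Theorems/SignedCensusLevelInduction.lean`). For the
same reason it does not import `Theorems/SignedCensusLevelInduction.lean` either but repeats its
thirty-line real induction: the file stays dependent on the fact-free prelude modules only.

The proof is pure logic plus the order-completeness of `ℝ`: let `P s` be the common graded predicate
(smooth no-hair up to horizon rotation level `s`); `P` is antitone in `s` (a larger level is a stronger
statement); put `S := {s ≥ 0 | ¬ P s}`; if `S ≠ ∅` let `t := inf S ≥ 0`; every level `0 ≤ s' < t`
satisfies `P`, so `P t` holds by `StaticAnchor` (`t = 0`) or `ClosedUnderRotation` (`t > 0`);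
`OpenUnderRotation` gives `P t'` for some `t' > t`, and antitonicity contradicts the choice of `t`.
Hence `∀ s, P s`, which is verbatim the hypothesis of the dynamical leg `NoHairToFinalState`; applying
the latter gives the Statement. No analysis, no new definitions, no named facts.
-/

namespace Summit.FinalStateConjecture.FinalStateConjecture.Theorems

-- the doubled `FinalStateConjecture.FinalStateConjecture` path component (D-0017, `<Problem> = <Summit>`) trips dupNamespace
set_option linter.dupNamespace false

open scoped BigOperators Topology Manifold Classical MeasureTheory ProbabilityTheory Matrix InnerProductSpace ComplexConjugate ContinuousMap
open Filter Set Function TopologicalSpace MeasureTheory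

set_option maxHeartbeats 400000 in
/-- **Assembly of route SignedCensus, frame form** (item stmt-FinalStateConjecture-10006):
`StaticAnchor → OpenUnderRotation → ClosedUnderRotation → NoHairToFinalState → FinalStateConjecture`.
Here `StaticAnchor` = level `0` is exotic-free (a regular smooth stationary AF vacuum black hole with
connected non-degenerate horizon on which the normalised stationary Killing field satisfies
`g(T,T) ≤ 0` has d.o.c. isometric to a subextremal Kerr exterior), `OpenUnderRotation` = the set of
exotic-free rotation levels is right-open (no-hair up to level `s ≥ 0` implies no-hair up to some level
`s' > s`), `ClosedUnderRotation` = it is left-closed (for `s > 0`, no-hair up to every level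
`0 ≤ s' < s` implies no-hair up to level `s`), and `NoHairToFinalState` = the dynamical leg (no-hair at
every level `s : ℝ` implies the Final State Conjecture as stated in
`Summits/FinalStateConjecture/Statement.lean`); all four written out verbatim so that this type unfolds
to the route decl `Summit.FinalStateConjecture.FinalStateConjecture.Theses.SignedCensus.Assembly` by
`δ`-reduction alone. Proof: real induction on the rotation level (the graded predicate `P s` is antitone
in `s`; if some level fails, `t := inf` of the failing levels `≥ 0` satisfies `P t` by the anchor
(`t = 0`) or by left-closedness (`t > 0`), and right-openness then yields a level `t' > t` with `P t'`,
contradicting the choice of `t`) gives graded no-hair at every level, and the dynamical leg turns it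
into the Statement. -/
theorem SignedCensus.assembly_frame_proof :
    (∀ (𝓑 : Literature.Geometry.Lorentzian.StationaryAFBlackHole.{0}) [𝓑.metric.HasLeviCivita] [Literature.Geometry.Lorentzian.Kerr.Facts] (hF : 𝓑.metric.isOpen_chronologicalFuture 𝓑.timeOrientation) (hP : 𝓑.metric.isOpen_chronologicalPast 𝓑.timeOrientation), 𝓑.metric.IsGloballyHyperbolic 𝓑.timeOrientation → 𝓑.metric.IsCauchyHypersurface 𝓑.timeOrientation (Set.range 𝓑.embed) → IsConnected 𝓑.horizon → 𝓑.toSpacetime.IsNonDegenerateHorizon 𝓑.Mext → Filter.Tendsto (fun x ↦ 𝓑.metric.val (𝓑.embed x) (𝓑.killing (𝓑.embed x)) (𝓑.killing (𝓑.embed x))) (⨅ R : ℝ, Filter.principal (𝓑.e.far R)) (nhds (-1)) → (∀ p ∈ 𝓑.horizon, 𝓑.metric.val p (𝓑.killing p) (𝓑.killing p) ≤ 0) → 𝓑.metric.toPseudoRiemannianMetric.IsRicciFlat → ∃ (M a : ℝ) (_ : Literature.Geometry.Lorentzian.Kerr.IsSubextremal M a) (Φ : Diffeomorph (𝓡 4)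 𝓘(ℝ, Literature.Geometry.Lorentzian.E4) (𝓑.docOpens hF hP) (Literature.Geometry.Lorentzian.Kerr.exterior M a) ((⊤ : ℕ∞) : WithTop ℕ∞)), ∀ (y : 𝓑.docOpens hF hP) (v w : EuclideanSpace ℝ (Fin 4)), (Literature.Geometry.Lorentzian.Kerr.smoothMetric M a (Literature.Geometry.Lorentzian.Kerr.rPlus M a)).val (Φ y) (mfderiv (𝓡 4) 𝓘(ℝ, Literature.Geometry.Lorentzian.E4) Φ y v) (mfderiv (𝓡 4) 𝓘(ℝ, Literature.Geometry.Lorentzian.E4) Φ y w) = 𝓑.metric.val y.1 v w) → (∀ s : ℝ, 0 ≤ s → (∀ (𝓑 : Literature.Geometry.Lorentzian.StationaryAFBlackHole.{0}) [𝓑.metric.HasLeviCivita] [Literature.Geometry.Lorentzian.Kerr.Facts] (hF : 𝓑.metric.isOpen_chronologicalFuture 𝓑.timeOrientation) (hP : 𝓑.metric.isOpen_chronologicalPast 𝓑.timeOrientation), 𝓑.metric.IsGloballyHyperbolic 𝓑.timeOrientation → 𝓑.metric.IsCauchyHypersurface 𝓑.timeOrientation (Set.range 𝓑.embed) → IsConnected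 𝓑.horizon → 𝓑.toSpacetime.IsNonDegenerateHorizon 𝓑.Mext → Filter.Tendsto (fun x ↦ 𝓑.metric.val (𝓑.embed x) (𝓑.killing (𝓑.embed x)) (𝓑.killing (𝓑.embed x))) (⨅ R : ℝ, Filter.principal (𝓑.e.far R)) (nhds (-1)) → (∀ p ∈ 𝓑.horizon, 𝓑.metric.val p (𝓑.killing p) (𝓑.killing p) ≤ s) → 𝓑.metric.toPseudoRiemannianMetric.IsRicciFlat → ∃ (M a : ℝ) (_ : Literature.Geometry.Lorentzian.Kerr.IsSubextremal M a) (Φ : Diffeomorph (𝓡 4) 𝓘(ℝ, Literature.Geometry.Lorentzian.E4) (𝓑.docOpens hF hP) (Literature.Geometry.Lorentzian.Kerr.exterior M a) ((⊤ : ℕ∞) : WithTop ℕ∞)), ∀ (y : 𝓑.docOpens hF hP) (v w : EuclideanSpace ℝ (Fin 4)), (Literature.Geometry.Lorentzian.Kerr.smoothMetric M a (Literature.Geometry.Lorentzian.Kerr.rPlus M a)).val (Φ y) (mfderiv (𝓡 4) 𝓘(ℝ, Literature.Geometry.Lorentzian.E4) Φ y v) (mfderiv (𝓡 4) 𝓘(ℝ,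 Literature.Geometry.Lorentzian.E4) Φ y w) = 𝓑.metric.val y.1 v w) → ∃ s' : ℝ, s < s' ∧ (∀ (𝓑 : Literature.Geometry.Lorentzian.StationaryAFBlackHole.{0}) [𝓑.metric.HasLeviCivita] [Literature.Geometry.Lorentzian.Kerr.Facts] (hF : 𝓑.metric.isOpen_chronologicalFuture 𝓑.timeOrientation) (hP : 𝓑.metric.isOpen_chronologicalPast 𝓑.timeOrientation), 𝓑.metric.IsGloballyHyperbolic 𝓑.timeOrientation → 𝓑.metric.IsCauchyHypersurface 𝓑.timeOrientation (Set.range 𝓑.embed) → IsConnected 𝓑.horizon → 𝓑.toSpacetime.IsNonDegenerateHorizon 𝓑.Mext → Filter.Tendsto (fun x ↦ 𝓑.metric.val (𝓑.embed x) (𝓑.killing (𝓑.embed x)) (𝓑.killing (𝓑.embed x))) (⨅ R : ℝ, Filter.principal (𝓑.e.far R)) (nhds (-1)) → (∀ p ∈ 𝓑.horizon, 𝓑.metric.val p (𝓑.killing p) (𝓑.killing p) ≤ s') → 𝓑.metric.toPseudoRiemannianMetric.IsRicciFlat → ∃ (M a : ℝ) (_ : Literature.Geometry.Lorentzian.Kerr.IsSubextremal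 M a) (Φ : Diffeomorph (𝓡 4) 𝓘(ℝ, Literature.Geometry.Lorentzian.E4) (𝓑.docOpens hF hP) (Literature.Geometry.Lorentzian.Kerr.exterior M a) ((⊤ : ℕ∞) : WithTop ℕ∞)), ∀ (y : 𝓑.docOpens hF hP) (v w : EuclideanSpace ℝ (Fin 4)), (Literature.Geometry.Lorentzian.Kerr.smoothMetric M a (Literature.Geometry.Lorentzian.Kerr.rPlus M a)).val (Φ y) (mfderiv (𝓡 4) 𝓘(ℝ, Literature.Geometry.Lorentzian.E4) Φ y v) (mfderiv (𝓡 4) 𝓘(ℝ, Literature.Geometry.Lorentzian.E4) Φ y w) = 𝓑.metric.val y.1 v w)) → (∀ s : ℝ, 0 < s → (∀ s' : ℝ, 0 ≤ s' → s' < s → (∀ (𝓑 : Literature.Geometry.Lorentzian.StationaryAFBlackHole.{0}) [𝓑.metric.HasLeviCivita] [Literature.Geometry.Lorentzian.Kerr.Facts] (hF : 𝓑.metric.isOpen_chronologicalFuture 𝓑.timeOrientation) (hP : 𝓑.metric.isOpen_chronologicalPast 𝓑.timeOrientation), 𝓑.metric.IsGloballyHyperbolic 𝓑.timeOrientation → 𝓑.metric.IsCauchyHypersurface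 𝓑.timeOrientation (Set.range 𝓑.embed) → IsConnected 𝓑.horizon → 𝓑.toSpacetime.IsNonDegenerateHorizon 𝓑.Mext → Filter.Tendsto (fun x ↦ 𝓑.metric.val (𝓑.embed x) (𝓑.killing (𝓑.embed x)) (𝓑.killing (𝓑.embed x))) (⨅ R : ℝ, Filter.principal (𝓑.e.far R)) (nhds (-1)) → (∀ p ∈ 𝓑.horizon, 𝓑.metric.val p (𝓑.killing p) (𝓑.killing p) ≤ s') → 𝓑.metric.toPseudoRiemannianMetric.IsRicciFlat → ∃ (M a : ℝ) (_ : Literature.Geometry.Lorentzian.Kerr.IsSubextremal M a) (Φ : Diffeomorph (𝓡 4) 𝓘(ℝ, Literature.Geometry.Lorentzian.E4) (𝓑.docOpens hF hP) (Literature.Geometry.Lorentzian.Kerr.exterior M a) ((⊤ : ℕ∞) : WithTop ℕ∞)), ∀ (y : 𝓑.docOpens hF hP) (v w : EuclideanSpace ℝ (Fin 4)), (Literature.Geometry.Lorentzian.Kerr.smoothMetric M a (Literature.Geometry.Lorentzian.Kerr.rPlus M a)).val (Φ y) (mfderiv (𝓡 4) 𝓘(ℝ, Literature.Geometry.Lorentzian.E4)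 Φ y v) (mfderiv (𝓡 4) 𝓘(ℝ, Literature.Geometry.Lorentzian.E4) Φ y w) = 𝓑.metric.val y.1 v w)) → ∀ (𝓑 : Literature.Geometry.Lorentzian.StationaryAFBlackHole.{0}) [𝓑.metric.HasLeviCivita] [Literature.Geometry.Lorentzian.Kerr.Facts] (hF : 𝓑.metric.isOpen_chronologicalFuture 𝓑.timeOrientation) (hP : 𝓑.metric.isOpen_chronologicalPast 𝓑.timeOrientation), 𝓑.metric.IsGloballyHyperbolic 𝓑.timeOrientation → 𝓑.metric.IsCauchyHypersurface 𝓑.timeOrientation (Set.range 𝓑.embed) → IsConnected 𝓑.horizon → 𝓑.toSpacetime.IsNonDegenerateHorizon 𝓑.Mext → Filter.Tendsto (fun x ↦ 𝓑.metric.val (𝓑.embed x) (𝓑.killing (𝓑.embed x)) (𝓑.killing (𝓑.embed x))) (⨅ R : ℝ, Filter.principal (𝓑.e.far R)) (nhds (-1)) → (∀ p ∈ 𝓑.horizon, 𝓑.metric.val p (𝓑.killing p) (𝓑.killing p) ≤ s) → 𝓑.metric.toPseudoRiemannianMetric.IsRicciFlat → ∃ (M a : ℝ) (_ : Literature.Geometry.Lorentzian.Kerr.IsSubextremal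 M a) (Φ : Diffeomorph (𝓡 4) 𝓘(ℝ, Literature.Geometry.Lorentzian.E4) (𝓑.docOpens hF hP) (Literature.Geometry.Lorentzian.Kerr.exterior M a) ((⊤ : ℕ∞) : WithTop ℕ∞)), ∀ (y : 𝓑.docOpens hF hP) (v w : EuclideanSpace ℝ (Fin 4)), (Literature.Geometry.Lorentzian.Kerr.smoothMetric M a (Literature.Geometry.Lorentzian.Kerr.rPlus M a)).val (Φ y) (mfderiv (𝓡 4) 𝓘(ℝ, Literature.Geometry.Lorentzian.E4) Φ y v) (mfderiv (𝓡 4) 𝓘(ℝ, Literature.Geometry.Lorentzian.E4) Φ y w) = 𝓑.metric.val y.1 v w) → ((∀ s : ℝ, ∀ (𝓑 : Literature.Geometry.Lorentzian.StationaryAFBlackHole.{0}) [𝓑.metric.HasLeviCivita] [Literature.Geometry.Lorentzian.Kerr.Facts] (hF : 𝓑.metric.isOpen_chronologicalFuture 𝓑.timeOrientation) (hP : 𝓑.metric.isOpen_chronologicalPast 𝓑.timeOrientation), 𝓑.metric.IsGloballyHyperbolic 𝓑.timeOrientation → 𝓑.metric.IsCauchyHypersurface 𝓑.timeOrientation (Set.range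 𝓑.embed) → IsConnected 𝓑.horizon → 𝓑.toSpacetime.IsNonDegenerateHorizon 𝓑.Mext → Filter.Tendsto (fun x ↦ 𝓑.metric.val (𝓑.embed x) (𝓑.killing (𝓑.embed x)) (𝓑.killing (𝓑.embed x))) (⨅ R : ℝ, Filter.principal (𝓑.e.far R)) (nhds (-1)) → (∀ p ∈ 𝓑.horizon, 𝓑.metric.val p (𝓑.killing p) (𝓑.killing p) ≤ s) → 𝓑.metric.toPseudoRiemannianMetric.IsRicciFlat → ∃ (M a : ℝ) (_ : Literature.Geometry.Lorentzian.Kerr.IsSubextremal M a) (Φ : Diffeomorph (𝓡 4) 𝓘(ℝ, Literature.Geometry.Lorentzian.E4) (𝓑.docOpens hF hP) (Literature.Geometry.Lorentzian.Kerr.exterior M a) ((⊤ : ℕ∞) : WithTop ℕ∞)), ∀ (y : 𝓑.docOpens hF hP) (v w : EuclideanSpace ℝ (Fin 4)), (Literature.Geometry.Lorentzian.Kerr.smoothMetric M a (Literature.Geometry.Lorentzian.Kerr.rPlus M a)).val (Φ y) (mfderiv (𝓡 4) 𝓘(ℝ, Literature.Geometry.Lorentzian.E4) Φ y v) (mfderiv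 (𝓡 4) 𝓘(ℝ, Literature.Geometry.Lorentzian.E4) Φ y w) = 𝓑.metric.val y.1 v w) → _root_.FinalStateConjecture) → _root_.FinalStateConjecture := by
  intro hA hO hC hD
  apply hD
  -- `P s` := smooth no-hair up to horizon rotation level `s` (the common inlined graded statement)
  set P : ℝ → Prop := fun s ↦ ∀ (𝓑 : Literature.Geometry.Lorentzian.StationaryAFBlackHole.{0}) [𝓑.metric.HasLeviCivita] [Literature.Geometry.Lorentzian.Kerr.Facts] (hF : 𝓑.metric.isOpen_chronologicalFuture 𝓑.timeOrientation) (hP : 𝓑.metric.isOpen_chronologicalPast 𝓑.timeOrientation), 𝓑.metric.IsGloballyHyperbolic 𝓑.timeOrientation → 𝓑.metric.IsCauchyHypersurface 𝓑.timeOrientation (Set.range 𝓑.embed) → IsConnected 𝓑.horizon → 𝓑.toSpacetime.IsNonDegenerateHorizon 𝓑.Mext → Filter.Tendsto (fun x ↦ 𝓑.metric.val (𝓑.embed x) (𝓑.killing (𝓑.embed x)) (𝓑.killing (𝓑.embed x))) (⨅ R : ℝ, Filter.principal (𝓑.e.far R)) (nhds (-1)) → (∀ p ∈ 𝓑.horizon,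 𝓑.metric.val p (𝓑.killing p) (𝓑.killing p) ≤ s) → 𝓑.metric.toPseudoRiemannianMetric.IsRicciFlat → ∃ (M a : ℝ) (_ : Literature.Geometry.Lorentzian.Kerr.IsSubextremal M a) (Φ : Diffeomorph (𝓡 4) 𝓘(ℝ, Literature.Geometry.Lorentzian.E4) (𝓑.docOpens hF hP) (Literature.Geometry.Lorentzian.Kerr.exterior M a) ((⊤ : ℕ∞) : WithTop ℕ∞)), ∀ (y : 𝓑.docOpens hF hP) (v w : EuclideanSpace ℝ (Fin 4)), (Literature.Geometry.Lorentzian.Kerr.smoothMetric M a (Literature.Geometry.Lorentzian.Kerr.rPlus M a)).val (Φ y) (mfderiv (𝓡 4) 𝓘(ℝ, Literature.Geometry.Lorentzian.E4) Φ y v) (mfderiv (𝓡 4) 𝓘(ℝ, Literature.Geometry.Lorentzian.E4) Φ y w) = 𝓑.metric.val y.1 v w with hP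
  -- a larger level is a stronger statement
  have mono : ∀ s s' : ℝ, s ≤ s' → P s' → P s := by
    intro s s' hss' h
    simp only [hP] at h ⊢
    intro 𝓑 _ _ hF hPa hgh hcs hconn hnd hfar hlev hvac
    exact h 𝓑 hF hPa hgh hcs hconn hnd hfar (fun p hp ↦ (hlev p hp).trans hss') hvac
  have h0 : P 0 := hA
  have hopen : ∀ s, 0 ≤ s → P s → ∃ s', s < s' ∧ P s' := hO
  have hclosed : ∀ s, 0 < s → (∀ s', 0 ≤ s' → s' < s → P s') → P s := hC
  -- real induction on the rotation level
  change ∀ s, P s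
  by_contra hnot
  push Not at hnot
  obtain ⟨s₀, hs₀⟩ := hnot
  set S : Set ℝ := {s | 0 ≤ s ∧ ¬ P s} with hS
  have hs₀S : max s₀ 0 ∈ S := by
    refine ⟨le_max_right _ _, fun h ↦ hs₀ (mono _ _ (le_max_left _ _) h)⟩
  have hne : S.Nonempty := ⟨_, hs₀S⟩
  have hbdd : BddBelow S := ⟨0, fun s hs ↦ hs.1⟩
  set t := sInf S with ht
  have ht0 : 0 ≤ t := le_csInf hne fun s hs ↦ hs.1
  have hbelow : ∀ s', 0 ≤ s' → s' < t → P s' := by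
    intro s' hs'0 hs't
    by_contra hns'
    exact (lt_irrefl _) ((csInf_le hbdd ⟨hs'0, hns'⟩).trans_lt hs't)
  have hPt : P t := by
    rcases ht0.eq_or_lt with h | h
    · rw [← h]; exact h0
    · exact hclosed t h hbelow
  obtain ⟨t', htt', hPt'⟩ := hopen t ht0 hPt
  obtain ⟨a, haS, hat'⟩ := exists_lt_of_csInf_lt hne htt'
  exact haS.2 (mono a t' hat'.le hPt')

end Summit.FinalStateConjecture.FinalStateConjecture.Theorems
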